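import Literature.Topology.FourManifolds.HostFamily
import Literature.Topology.FourManifolds.ReflectTemplate
import Literature.Topology.FourManifolds.ConnectedSumNormalForm
import HarnessLib

/-!
# The model bridge: the host of one flip frame is the reflected host of another

Topic `Literature/Topology/FourManifolds` (trunk T-4MAN). Fact seat
`provefact-Literature.Topology.FourManifolds.Knot.IsConnectedSum.isIsotopic` (Schubert's theorem),
geometric heart for rail knots. For two flip pairs `(b, c)` and `(b₁, b₂)` at flat scales
(`FlatHost.FlatHyp`, with the hypotheses at all smaller scales), the host of the flip frame of
`b` at `u = 0` is isotopic to the **reflected** host of the flip frame of `b₁` at `u = 1`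
(`isIsotopic_host_zero_map_host_one`): both are template knots up to isotopy
(`HostFlatten.isIsotopic_host_templateKnot`, `HostFamily.isIsotopic_host_zero_one`), and the
reflected template knot of `b₁` is isotopic to the template knot of `b`
(`ReflectTemplate.isIsotopic_map_templateKnot_templateKnot`).

Everything is proved; no named facts are introduced.

## References

* M. W. Hirsch, *Differential Topology*, GTM 33 (1976), Ch. 8 §1, Thm. 1.3. [HirschDT1976]
-/

open scoped Manifold ContDiff Topology Real
open Function Set Metric Filter

noncomputable section

namespace Literature.Topology.FourManifolds

/-- Local notation: `𝔼 n` is the model Euclidean space `EuclideanSpace ℝ (Fin n)`. -/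
local notation "𝔼 " n:arg => EuclideanSpace ℝ (Fin n)

/-- Local notation: `𝕊 n` is the unit sphere in `EuclideanSpace ℝ (Fin (n + 1))`. -/
local notation "𝕊 " n:arg => (Metric.sphere (0 : EuclideanSpace ℝ (Fin (n + 1))) 1)

attribute [local instance] fact_finrank_euclideanSpace_succ

open KnotsInBall ExitBend ModelTemplate

namespace BandData

namespace FlatHyp

variable {A B K : Knot} {b : BandData A B K ∅} {Ac Bc Kc : Knot} {c : BandData Ac Bc Kc ∅}
  {hcross : b.band ⁻¹' sphereEquator 2 ∩ squareNhd b.δ = {x ∈ squareNhd b.δ | x 0 = 2⁻¹}}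
  {hcrossc : c.band ⁻¹' sphereEquator 2 ∩ squareNhd c.δ = {x ∈ squareNhd c.δ | x 0 = 2⁻¹}}
  {ε r A' εc rc ε' r' κ : ℝ} (Hb : FlatHyp hcross hcrossc ε r A' εc rc ε' r' κ)
  {A₁ B₁ K₁ : Knot} {b₁ : BandData A₁ B₁ K₁ ∅} {A₂ B₂ K₂ : Knot} {b₂ : BandData A₂ B₂ K₂ ∅}
  {hcross₁ : b₁.band ⁻¹' sphereEquator 2 ∩ squareNhd b₁.δ = {x ∈ squareNhd b₁.δ | x 0 = 2⁻¹}}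
  {hcross₂ : b₂.band ⁻¹' sphereEquator 2 ∩ squareNhd b₂.δ = {x ∈ squareNhd b₂.δ | x 0 = 2⁻¹}}
  {ε₁ r₁ A₁' ε₂ r₂ ε₁' r₁' κ₁ : ℝ} (H₁ : FlatHyp hcross₁ hcross₂ ε₁ r₁ A₁' ε₂ r₂ ε₁' r₁' κ₁)

/-- **THE MODEL BRIDGE**: the host of the flip frame of `b` at `u = 0` is isotopic to the reflected
host of the flip frame of `b₁` at `u = 1` (flat hypotheses for both pairs at all smaller scales,
smallness of `κ₁` on the template). [cite: HirschDT1976, Ch. 8 §1, Thm. 1.3] -/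
theorem isIsotopic_host_zero_map_host_one
    (Hball : ∀ κ', 0 < κ' → κ' ≤ κ → FlatHyp hcross hcrossc ε r A' εc rc ε' r' κ')
    (H₁all : ∀ κ', 0 < κ' → κ' ≤ κ₁ → FlatHyp hcross₁ hcross₂ ε₁ r₁ A₁' ε₂ r₂ ε₁' r₁' κ')
    (hsmall : ∀ s, ‖κ₁ • b₁.frame hcross₁ (template b₁.depthSign s)‖ ≤ 1 / 2) :
    (Hb.host zero_mem01).IsIsotopic ((H₁.host one_mem01).map (reflectLastDiffeo 3)) := by
  have h1 := Hb.isIsotopic_host_templateKnot Hball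
  have h2 := ((H₁.isIsotopic_host_templateKnot H₁all).map_congr (reflectLastDiffeo 3))
  have h3 := IsFlipPair.isIsotopic_map_templateKnot_templateKnot H₁.pair hcross₁ hcross₂ H₁.κ_pos b₁.depthSign hsmall b hcross Hb.κ_pos
    b.depthSign
  have h4 := (H₁.isIsotopic_host_zero_one).map_congr (reflectLastDiffeo 3)
  exact IsAmbientIsotopic.trans_holds h1 (IsAmbientIsotopic.trans_holds (IsAmbientIsotopic.symm_holds h3)
    (IsAmbientIsotopic.trans_holds (IsAmbientIsotopic.symm_holds h2) h4))

end FlatHyp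

end BandData

end Literature.Topology.FourManifolds
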